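import Mathlib
import Summits.HodgeConjecture.HodgeConjecture.Theses.CurveNetMordellWeil

/-!
# Sketch — crux-ideate stmt-HodgeConjecture-2782 (`VerticalSupportMiddle`), ideator 2, round 1

First lemmas of the two idea cards filed by this seat, stated over existing declarations so that
they ELABORATE (no proof is claimed; Props are defined, the finite BWB certificate is `decide`d).

* Card `koszul-bott-interior-vanishing`: the Borel–Weil–Bott numerology certifying that the single
  coherent "interior obstruction group" `𝔊(0) = H^q(ℙ^{2q-1}, pr_*ω_{X'/ℙ} ⊗ Ω^{q-1})` has NO
  non-zero E₁-term in the Koszul–Beilinson presentation of the Hodge bundle of a generic curve net,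
  for `q = 2, 3, 4, 5` (and the closed-form Bott pattern for the wedge constituents, all `q ≥ 2`).
* Card `vertical-span-duality`: the Poincaré-dual DETECTION form of the crux, typed on the real
  carriers (`complexBetti`, restriction to the complex points of `pr⁻¹ T`), and the statement
  `VerticalSupportMiddle ↔ VerticalDetection` that a prover lands first.
-/

set_option linter.dupNamespace false

namespace Summit.HodgeConjecture.HodgeConjecture.Cruxes.VerticalSupportMiddle.IdeatorTwo

open Literature.AlgebraicGeometry

/-! ## Part B — Bott / Borel–Weil–Bott certificate (card `koszul-bott-interior-vanishing`) -/

/-- Bott's non-vanishing pattern for `H^a(ℙ^m, Ω^p(k))`: non-zero iff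
`(a = p ∧ k = 0) ∨ (a = 0 ∧ k > p) ∨ (a = m ∧ k < p - m)` (Bott 1957; Okonek–Schneider–Spindler I.1.1). -/
def bottNonzero (m a p : ℕ) (k : ℤ) : Prop :=
  (a = p ∧ k = 0) ∨ (a = 0 ∧ (p : ℤ) < k) ∨ (a = m ∧ k < (p : ℤ) - m)

/-- The WEDGE constituent `Ω^{i+q-1}(i+1)` of the `i`-th Koszul column `Ω^i(i+1) ⊗ Ω^{q-1}`
(twist `t = 0`) has no cohomology in degree `q + i` on `ℙ^{2q-1}`, for every `q ≥ 2` and every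
column `i ≤ 2q-2` — the closed-form part of `𝔊(0) = 0` (pure `omega` arithmetic). -/
theorem wedge_column_vanishes (q i : ℕ) (hq : 2 ≤ q) (_hi : i + 1 ≤ 2 * q - 1) :
    ¬ bottNonzero (2 * q - 1) (q + i) (i + q - 1) ((i : ℤ) + 1) := by
  unfold bottNonzero; omega

/-- For `q = 1` (the excluded Mordell–Weil case, base `ℙ¹`) the same column DOES contribute:
`H¹(ℙ¹, Ω⁰(k))`-type terms survive for negative twists — sanity check that the numerology is sharp. -/
theorem wedge_column_q_one_survives : bottNonzero 1 1 0 (-2) := by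
  unfold bottNonzero; omega

/-- `ρ = (N-1, N-2, …, 0)` for `GL_N`. -/
def rhoList (N : ℕ) : List ℤ := (List.range N).reverse.map (fun j => (j : ℤ))

/-- Number of inversions (pairs `i < j` with `v_i < v_j`) of a list. -/
def inversions : List ℤ → ℕ
  | [] => 0
  | x :: xs => (xs.filter (fun y => x < y)).length + inversions xs

/-- Borel–Weil–Bott on `ℙ^m = GL_{m+1}/P` for the homogeneous bundle `S_λ(Q^∨) ⊗ O(k)`
(`Q = T(-1)` the universal quotient; calibrated convention `O(k) ↔ (k; 0…0)`, `Q^∨ ↔ (0; 1,0,…)`):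
with `χ = (k; λ)` padded to length `m+1`, if `χ + ρ` has a repeated entry all cohomology vanishes
(`none`), otherwise the unique non-zero cohomology sits in degree `#inversions(χ + ρ)` (Bott 1957;
Weyman, Cohomology of Vector Bundles and Syzygies, Cor. 4.1.9). -/
def bwbDegree (m : ℕ) (k : ℤ) (lam : List ℤ) : Option ℕ :=
  let chi : List ℤ := k :: (lam ++ List.replicate (m - lam.length) 0)
  let v : List ℤ := List.zipWith (· + ·) chi (rhoList (m + 1))
  if v.Nodup then some (inversions v) else none

/-- The two-column Littlewood–Richardson constituents of `∧^i ⊗ ∧^p` (Pieri): `(2^j, 1^{i+p-2j})`,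
`0 ≤ j ≤ min i p`, of length `≤ m`. -/
def twoColumnLR (i p m : ℕ) : List (List ℤ) :=
  ((List.range (min i p + 1)).filter (fun j => i + p - j ≤ m)).map
    (fun j => List.replicate j 2 ++ List.replicate (i + p - 2 * j) 1)

/-- The finite E₁-audit at twist `t`: every Koszul column `i < m = 2q-1` of
`Rpr_*ω_{X'/ℙ} ⊗ Ω^{q-1}(t)` (bundle `⊕_λ S_λ(Q^∨)(2-q+t)`, coefficient space `H⁰(X, K_X+(m-i)L)`)
has NO cohomology in degree `q+i` (total degree `q`). `true` = certificate holds. -/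
def interiorE1Vanishes (q : ℕ) (t : ℤ) : Bool :=
  let m := 2 * q - 1
  (List.range m).all fun i =>
    (twoColumnLR i (q - 1) m).all fun lam => bwbDegree m (2 - (q : ℤ) + t) lam ≠ some (q + i)

/-- CERTIFICATE (kernel-checked by `decide`): for `q = 2, 3, 4, 5` and twist `t = 0` the interior
E₁-page of `𝔊(0) = H^q(ℙ^{2q-1}, Ē ⊗ Ω^{q-1})` is empty; the only surviving term of the full complex
in total degree `q` is the tail `H^{q-1}(Ω^{q-1}) ⊗ H^{2q}(X, K_X) = ℂ`, which is the
`R¹pr_*ω_{X'/ℙ} = 𝒪` summand — hence `𝔊(0) = 0` (see card, First lemma). Also recorded: the first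
negative twist where the audit fails is `t = 3 - 2q - 1` (terms built from `H^{q,0}(X)`). -/
theorem interior_E1_vanishes_q2 : interiorE1Vanishes 2 0 = true := by decide
theorem interior_E1_vanishes_q3 : interiorE1Vanishes 3 0 = true := by decide
theorem interior_E1_vanishes_q4 : interiorE1Vanishes 4 0 = true := by decide
theorem interior_E1_vanishes_q5 : interiorE1Vanishes 5 0 = true := by decide
/-- Positive twists are harmless too (q = 2, 3; t = 1, 2). -/
theorem interior_E1_vanishes_pos : (interiorE1Vanishes 2 1 && interiorE1Vanishes 2 2 &&
    interiorE1Vanishes 3 1 && interiorE1Vanishes 3 2) = true := by decide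
/-- Sharpness: at `q = 2`, `t = -4` the interior audit FAILS (column `i = 1`: `S_{(1,1)}(Q^∨)(-4)` and
`S_{(2)}(Q^∨)(-4)` have `H³`); at `t = -3` only the TAIL term `H³(Ω¹(-3)) ⊗ H²(X,K_X) ≅ ℂ⁴ ⊗ H^{2,0}(X)^*`
survives (tails are not part of this column audit) — the numerology is sharp exactly where the
hand computation says. -/
theorem interior_E1_fails_q2_tneg4 : interiorE1Vanishes 2 (-4) = false := by decide
theorem interior_E1_vanishes_q2_tneg3 : interiorE1Vanishes 2 (-3) = true := by decide
/-- Calibration of the BWB convention against Bott's closed formula: `O(k)` on `ℙ³`, `Ω¹ = Q^∨(-1)`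
has `H¹ = ℂ`, `Ω¹(1) = Q^∨` is acyclic, `Ω²(2) = ∧²Q^∨` is acyclic, `Ω² = ∧²Q^∨(-2)` has `H²`. -/
theorem bwb_calibration :
    bwbDegree 3 0 [] = some 0 ∧ bwbDegree 3 (-1) [] = none ∧ bwbDegree 3 (-4) [] = some 3 ∧
    bwbDegree 3 (-1) [1] = some 1 ∧ bwbDegree 3 0 [1] = none ∧ bwbDegree 3 0 [1, 1] = none ∧
    bwbDegree 3 (-2) [1, 1] = some 2 := by decide

/-! ## Part A — the Poincaré-dual DETECTION form (card `vertical-span-duality`) -/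

section Detection

variable (X : Motives.SchemeOver ℂ)

/-- The complex points of `X` lying over a subset `Z ⊆ X` (for `Z` Zariski-closed: `Z(ℂ)` with
its analytic topology), as a subspace of `X(ℂ)` — the companion of the tree's
`Motives.complexPointsCompl`. -/
abbrev complexPointsOn (Z : Set X.left) : Type :=
  {P : Motives.ComplexPoints X // P.pt ∈ Z}

/-- Restriction `Hⁱ(X(ℂ); ℂ) ⟶ Hⁱ(Z(ℂ); ℂ)` to the complex points over `Z`. -/
noncomputable abbrev complexBetti.restrictTo (Z : Set X.left) (i : ℕ) :
    HodgeTheory.complexBetti X i ⟶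
      Literature.AlgebraicTopology.SingularHomology.singularCohomology ℂ ℂ (complexPointsOn X Z) i :=
  Literature.AlgebraicTopology.SingularHomology.singularCohomology.map ℂ ℂ
    (⟨Subtype.val, continuous_subtype_val⟩ : C(complexPointsOn X Z, Motives.ComplexPoints X)) i

end Detection

/-- **Detection form of the crux.** `X` smooth projective of dimension `2q ≥ 4`, `pr : X ⟶ ℙ^{2q-1}`
surjective: a rational `(q,q)`-class that restricts to ZERO on `pr⁻¹(T)(ℂ)` for EVERY proper
Zariski-closed `T ⊊ ℙ^{2q-1}` is zero ("every non-zero Hodge class is seen by some vertical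
hypersurface"). Card `vertical-span-duality` claims `VerticalSupportMiddle ↔ VerticalDetection`
(Poincaré duality `I_T = K_T^⊥` on `H^{2q}(X(ℂ))`, `Alg^q ⊆ V_∞` for `q ≥ 2`, and polarisable-HS
semisimplicity + Hodge–Riemann non-degeneracy on `Hdg^q`). -/
def VerticalDetection : Prop :=
  ∀ ⦃q m : ℕ⦄ ⦃X : Motives.SchemeOver ℂ⦄ (pr : X ⟶ Motives.projectiveSpace m ℂ),
    Motives.IsSmoothProjective (2 * q) X → 2 ≤ q → m + 1 = 2 * q →
    Function.Surjective pr.left.base →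
    ∀ c : HodgeTheory.complexBetti X (2 * q), HodgeTheory.IsRationalClass c →
      HodgeTheory.IsOfHodgeType (2 * q) X (2 * q) q q c →
      (∀ T : Set (Motives.projectiveSpace m ℂ).left, IsClosed T → T ≠ Set.univ →
        complexBetti.restrictTo X (pr.left.base ⁻¹' T) (2 * q) c = 0) →
      c = 0

/-- **Algebraic classes are vertical for `q ≥ 2`** (dimension count: a codimension-`q` support has
dimension `q < 2q - 1`, so its image under the proper map `pr` is a proper closed subset): the
first, provable-now lemma shared by both cards (it is what makes the duality flip exact and is the
cohomological shadow of Beauville's `CH^q_{(2q-1)}(J_η) = 0`). -/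
def AlgebraicClassesAreVertical : Prop :=
  ∀ ⦃q m : ℕ⦄ ⦃X : Motives.SchemeOver ℂ⦄ (pr : X ⟶ Motives.projectiveSpace m ℂ),
    Motives.IsSmoothProjective (2 * q) X → 2 ≤ q → m + 1 = 2 * q →
    HodgeTheory.algebraicClasses X q ≤ Submodule.span ℂ {c : HodgeTheory.complexBetti X (2 * q) |
      ∃ T : Set (Motives.projectiveSpace m ℂ).left, IsClosed T ∧ T ≠ Set.univ ∧
        HodgeTheory.complexBetti.restrictCompl X (pr.left.base ⁻¹' T) (2 * q) c = 0}

/-- First lemma of card `vertical-span-duality` (statement; proof = Poincaré duality on the closed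
oriented `4q`-manifold `X(ℂ)` + Kronecker perfectness on the compact `pr⁻¹T(ℂ)` + semisimplicity). -/
def DetectionDuality : Prop :=
  Theses.CurveNetMordellWeil.VerticalSupportMiddle ↔ VerticalDetection

/-- The easy direction's first step type-checks against the route decl: the crux quantifies over
exactly the data the detection form uses. -/
example (h : Theses.CurveNetMordellWeil.VerticalSupportMiddle) {q m : ℕ} {X : Motives.SchemeOver ℂ}
    (pr : X ⟶ Motives.projectiveSpace m ℂ) (hX : Motives.IsSmoothProjective (2 * q) X)
    (hq : 2 ≤ q) (hm : m + 1 = 2 * q) (hs : Function.Surjective pr.left.base) :=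
  h pr hX hq hm hs

end Summit.HodgeConjecture.HodgeConjecture.Cruxes.VerticalSupportMiddle.IdeatorTwo
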